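import Literature.NumberTheory.EllipticCurves.Kim2025.FineMainIdentityOffP
import HarnessLib

/-!
# C.-H. Kim, arXiv:2505.09121v1, Thm. 3.19 (SU) for an elliptic curve AT EVERY HEIGHT-ONE PRIME, in
# its printed (FINE) currency — Kato's main identity `char_Λ(𝐇¹_Γ(T_pW)/Z) = char_Λ(X₀(E/ℚ_∞))`
# on the Skinner–Urban class, PROVED from the tree's refereed fact bsd.S21 over Kato's §17.13 package
# (theorems only)

Topic `NumberTheory/EllipticCurves`, sub-directory `Kim2025`; namespace
`Literature.NumberTheory.EllipticCurves.Kim2025`.  Typing layer (cell `bsd-littype`, seat 09, gen 4);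
fourth fine-currency companion (after `MainIdentityAtAugmentationFineDictionary` — the prime `(T)`,
`FineOneSidedDivisibility` — Thm. 3.18 (1), `FineMainIdentityOffP` — Thm. 3.19 off `(p)`).  HONEST
FRAMING: THEOREMS ONLY (0 definitions, 0 named facts); the research inputs are the tree's NAMED facts
passed as explicit hypotheses (`skinner_urban_main_conjecture` = Skinner–Urban 2014 Thm. 3.6.9,
refereed; `Kato2004.exists_divisibilityInputs_fineQuotient`, `Kato2004.thm12_4`); nothing is booked;
BSD is not advanced.

The printed statement (held text `paper:arxiv-2505.09121`, §3.5.3, chunk p0014:L75–L77):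

> **Theorem 3.19 (SU).** Suppose that `ψ = 𝟙` and `f` is good ordinary at `p` and `p`-distinguished.
> If `ρ_f` has large image, `k ≡ 2 (mod p − 1)`, and there exists a prime `ℓ` exactly dividing `N`
> where `ρ̄_f` is ramified, then
> `ord_𝔓(char_Λ(H¹_Iw(ℚ, T_f(k−1))/Λκ^{Kato,k−1,∞}_1)) = ord_𝔓(char_Λ(Sel₀(ℚ_∞, W_f(1))^∨))`
> for every height one prime `𝔓` of `Λ`.

For `E/ℚ` (`k = 2`, so `k ≡ 2 (mod p−1)` is empty; "large image" = `ρ_{E,p^m}` onto for all `m`, the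
tree's tower hypothesis; "`ℓ ∥ N` with `ρ̄` ramified at `ℓ`" = a multiplicative prime `ℓ ≠ p` with
`p ∤ ord_ℓ(Δ_E)`, the `haux` of the tree fact bsd.S21) the Mazur-form input is Skinner–Urban Thm. 3.6.9
INCLUDING its integral clause 3 under tower surjectivity (`char_Λ X = (g)`, `ι g = L_p(E,T)`), which
reaches the prime `(p)` as well.  What this file adds to `FineMainIdentityOffP`:

* `lengthAt_eq_zero_of_finite_heightOne` — a FINITE `Λ`-module has local length `0` at EVERY
  height-one prime of `Λ = ℤ_p⟦T⟧`, the prime `(p)` included (at `(p)`: a monic polynomial in `T`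
  kills it, Washington §13.2 — tree lemma `lengthAt_eq_zero_of_finite`; off `(p)`: its order does);
* `fine_iff_mazur_heightOne` — the Poitou–Tate dictionary at EVERY height-one prime (the off-`(p)`
  restriction of `fine_iff_mazur_offP` removed);
* `fine_heightOne_of_charIdeal_eq_span_integral` — the INTEGRAL Mazur identity `char X = (g)`,
  `ι g = L_p` gives the fine identity `ℓ_𝔭(𝐇¹_Γ/Z) = ℓ_𝔭(Y)` at every height-one `𝔭`, hence
  **`char_Λ(𝐇¹_Γ/Z) = char_Λ(Y)`** (`charIdeal_quotient_zeta_eq_of_charIdeal_eq_span_integral`);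
* `fine_heightOne_of_skinnerUrban`, `charIdeal_quotient_zeta_eq_charIdeal_fine_of_skinnerUrban` —
  **Thm. 3.19 (SU) for `E` VERBATIM (every height-one prime) and its characteristic-ideal form**, over
  a package with fine quotient; `exists_charIdeal_quotient_zeta_eq_of_skinnerUrban_of_fineQuotient` —
  the instance on `WeierstrassCurve.FineSelmerDualData` (Kato's main identity in the `X₀` form of
  statement 3.17 for `E` on the S–U class, modulo the named facts by name).

READING of `Z` as Kim's `Λκ^{Kato,∞}_1` (Kato Thm. 12.6 `Z`, finite index in `Z(f,T) = Λ z_γ`): as in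
the companions; scope good ordinary `p ≥ 3`.

## References
* C.-H. Kim (app. with R. Pollack), arXiv:2505.09121v1 (2025), Thm. 3.19 (SU), statement 3.17
  (§3.5.3). [Kim2025RefinedTNC]
* C. Skinner, E. Urban, Invent. Math. 195 (2014), Thm. 3.6.9 (p. 45). [SkinnerUrban2014]
* K. Kato, Astérisque 295 (2004), Thm. 12.4–12.6 (pp. 221–222), §17.13 (pp. 279–280). [Kato2004Asterisque]
* L. Washington, *Introduction to Cyclotomic Fields*, §13.2. [Washington1997]
-/

noncomputable section

open scoped MatrixGroups ModularForm Classical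

open CongruenceSubgroup Literature.NumberTheory.EllipticCurves.ModularForms
  Literature.NumberTheory.EllipticCurves Literature.NumberTheory.EllipticCurves.Module
  Literature.NumberTheory.EllipticCurves.IwasawaAlgebra
open Field Literature.NumberTheory.GaloisRepresentations
open Literature.NumberTheory.EllipticCurves.Kato2004
open Literature.NumberTheory.EllipticCurves.Kato2004.EulerSystemValues

universe u

namespace Literature.NumberTheory.EllipticCurves.Kim2025

/-! ### `Λ`-algebra: finite modules die at every height-one prime -/

section Algebra

variable {p : ℕ} [Fact p.Prime]

/-- A height-one prime of `Λ = ℤ_p⟦T⟧` containing the constant `p` IS `(p)` (two comparable primes of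
the same finite height coincide). [cite: Washington1997, §13.2] -/
theorem asIdeal_eq_augIdealP_of_C_mem (𝔭 : PrimeSpectrum (IwasawaAlgebra p))
    (h𝔭 : 𝔭.asIdeal.height = 1) (hp𝔭 : PowerSeries.C (p : ℤ_[p]) ∈ 𝔭.asIdeal) :
    𝔭.asIdeal = augIdealP p := by
  haveI : (augIdealP p).IsPrime := isPrime_augIdealP_holds p
  have hle : augIdealP p ≤ 𝔭.asIdeal := by
    rw [augIdealP, Ideal.span_singleton_le_iff_mem]
    exact hp𝔭
  have hne : augIdealP p ≠ ⊥ := by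
    rw [augIdealP, Ne, Ideal.span_singleton_eq_bot, ← map_zero (PowerSeries.C (R := ℤ_[p])),
      PowerSeries.C_injective.eq_iff]
    exact_mod_cast (Fact.out : p.Prime).ne_zero
  exact (eq_of_height_le_one_of_le h𝔭.le hne hle).symm

/-- **A FINITE `Λ`-module has local length `0` at EVERY height-one prime `𝔭` of `Λ`.**  Off `(p)` its
order `#C = p^a·u` has a factor `u ∉ 𝔭` killing `p^a C`… (tree `Kato2004.lengthAt_eq_zero_of_finite_of_C_not_mem`);
at `𝔭 = (p)` a MONIC polynomial in `T` kills the finitely generated `ℤ_p`-module `C`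
(Cayley–Hamilton) and no monic polynomial lies in `(p)` (Washington §13.2; tree
`lengthAt_eq_zero_of_finite`). [cite: Washington1997, §13.2] -/
theorem lengthAt_eq_zero_of_finite_heightOne (C : Type*) [AddCommGroup C]
    [_root_.Module (IwasawaAlgebra p) C] [Finite C] (𝔭 : PrimeSpectrum (IwasawaAlgebra p))
    (h𝔭 : 𝔭.asIdeal.height = 1) : lengthAt (IwasawaAlgebra p) C 𝔭 = 0 := by
  by_cases hp𝔭 : PowerSeries.C (p : ℤ_[p]) ∈ 𝔭.asIdeal
  · letI : _root_.Module ℤ_[p] C := _root_.Module.compHom C (algebraMap ℤ_[p] (IwasawaAlgebra p))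
    haveI : IsScalarTower ℤ_[p] (IwasawaAlgebra p) C :=
      IsScalarTower.of_algebraMap_smul fun _ _ ↦ rfl
    exact lengthAt_eq_zero_of_finite p C 𝔭 (asIdeal_eq_augIdealP_of_C_mem 𝔭 h𝔭 hp𝔭)
  · exact lengthAt_eq_zero_of_finite_of_C_not_mem C 𝔭 hp𝔭

end Algebra

/-! ### Over Kato's §17.13 package with a fine quotient, at EVERY height-one prime -/

section Package

variable {p : ℕ} [Fact p.Prime] {W : WeierstrassCurve ℚ} [W.IsElliptic] [W.IsGloballyMinimal]
  [ContinuousSMul ℤ_[p] (W.tateModule p)] {N : ℕ} [NeZero N] {f : CuspForm (Gamma0 N) 2}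
  {κ : ZpExtension ℚ p} {γ : absoluteGaloisGroup ℚ}
  {I : IwasawaH1Data W p κ γ} {D : W.SelmerDualData κ γ}
  {Y : Type u} [AddCommGroup Y] [_root_.Module (IwasawaAlgebra p) Y]

omit [NeZero N] in
/-- `ℓ_𝔭(Y) = ℓ_𝔭(𝐇²)` at EVERY height-one `𝔭` (`Im ε ⊆ 𝐇²_loc` finite, (17.13.4)).
[cite: Kato2004Asterisque, §17.13 (17.13.1), (17.13.4) (p. 279)] -/
theorem lengthAt_fine_eq_lengthAt_H2_heightOne (K : DivisibilityInputs W p f κ γ I D)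
    (π : D.X →ₗ[IwasawaAlgebra p] Y) (hπs : Function.Surjective π) (hπ : Function.Exact K.toX π)
    (𝔭 : PrimeSpectrum (IwasawaAlgebra p)) (h𝔭 : 𝔭.asIdeal.height = 1) :
    lengthAt (IwasawaAlgebra p) Y 𝔭 = lengthAt (IwasawaAlgebra p) K.H2 𝔭 := by
  have h := lengthAt_fine_add_lengthAt_range_eq K π hπs hπ 𝔭
  haveI := K.finite_H2loc
  haveI : Finite (LinearMap.range K.ε) := Finite.of_injective _ Subtype.val_injective
  rwa [lengthAt_eq_zero_of_finite_heightOne (LinearMap.range K.ε) 𝔭 h𝔭, add_zero] at h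

omit [NeZero N] in
/-- **Kato's p. 280 identity at EVERY height-one prime, fine quotient in place of `𝐇²`:
`ℓ_𝔭(X) + ℓ_𝔭(𝐇¹_Γ/Z) = ℓ_𝔭(Λ/(G₁)) + ℓ_𝔭(Y)`** (`E[p]` irreducible, `ι G₁ = L_p(E,T)`).
[cite: Kato2004Asterisque, §17.13 (p. 280), Prop. 17.11 (p. 277), Thm. 16.6 (p. 271)] -/
theorem lengthAt_add_lengthAt_quotient_zeta_eq_heightOne (K : DivisibilityInputs W p f κ γ I D)
    (hirr : W.HasIrreducibleModPGaloisRep p) {G₁ : IwasawaAlgebra p}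
    (hG₁ : iwasawaToPowerSeries p G₁ = padicLFunction f (unitRoot W p : ℚ_[p]))
    (π : D.X →ₗ[IwasawaAlgebra p] Y) (hπs : Function.Surjective π) (hπ : Function.Exact K.toX π)
    (𝔭 : PrimeSpectrum (IwasawaAlgebra p)) (h𝔭 : 𝔭.asIdeal.height = 1) :
    lengthAt (IwasawaAlgebra p) D.X 𝔭 + lengthAt (IwasawaAlgebra p) (I.H ⧸ K.Z) 𝔭 =
      lengthAt (IwasawaAlgebra p) (IwasawaAlgebra p ⧸ Ideal.span {G₁}) 𝔭 +
        lengthAt (IwasawaAlgebra p) Y 𝔭 := by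
  haveI := K.finite_coker_col
  haveI := K.finite_H2loc
  have h := lengthAt_add_eq_of_skeleton K.loc K.loc_injective K.toX K.δ K.ε K.exact_P K.exact_X
    K.exact_H2 K.col K.col_injective K.Z 𝔭
    (lengthAt_eq_zero_of_finite_heightOne (IwasawaAlgebra p ⧸ LinearMap.range K.col) 𝔭 h𝔭)
    (lengthAt_eq_zero_of_finite_heightOne K.H2loc 𝔭 h𝔭)
    (lengthAt_quotient_colLocZ_eq K hirr hG₁ 𝔭 h𝔭)
  rwa [← lengthAt_fine_eq_lengthAt_H2_heightOne K π hπs hπ 𝔭 h𝔭] at h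

omit [NeZero N] in
/-- **Fine identity ⟺ Mazur identity at EVERY height-one prime, over the package** ([K25] proof of
Thm. 3.19, "equivalent … via the global Poitou–Tate duality"; the prime `(p)` included):
`ℓ_𝔭(𝐇¹_Γ/Z) = ℓ_𝔭(Y) ↔ ℓ_𝔭(X(E/ℚ_∞)) = ℓ_𝔭(Λ/(G₁))`, for `E[p]` irreducible and `ι G₁ = L_p ≠ 0`.
[cite: Kim2025RefinedTNC, proof of Thm. 3.19 (§3.5.3, chunk p0014:L78–L81)] [cite: Kato2004Asterisque, §17.13 (p. 280)] -/
theorem fine_iff_mazur_heightOne (K : DivisibilityInputs W p f κ γ I D)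
    (hirr : W.HasIrreducibleModPGaloisRep p) {G₁ : IwasawaAlgebra p}
    (hG₁ : iwasawaToPowerSeries p G₁ = padicLFunction f (unitRoot W p : ℚ_[p]))
    (hL : padicLFunction f (unitRoot W p : ℚ_[p]) ≠ 0)
    (π : D.X →ₗ[IwasawaAlgebra p] Y) (hπs : Function.Surjective π) (hπ : Function.Exact K.toX π)
    (𝔭 : PrimeSpectrum (IwasawaAlgebra p)) (h𝔭 : 𝔭.asIdeal.height = 1) :
    lengthAt (IwasawaAlgebra p) (I.H ⧸ K.Z) 𝔭 = lengthAt (IwasawaAlgebra p) Y 𝔭 ↔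
      lengthAt (IwasawaAlgebra p) D.X 𝔭 =
        lengthAt (IwasawaAlgebra p) (IwasawaAlgebra p ⧸ Ideal.span {G₁}) 𝔭 := by
  have h := lengthAt_add_lengthAt_quotient_zeta_eq_heightOne K hirr hG₁ π hπs hπ 𝔭 h𝔭
  have hG0 : G₁ ≠ 0 := by
    rintro rfl
    exact hL (by rw [← hG₁, map_zero])
  have hby : Module.IsTorsionBy (IwasawaAlgebra p) (IwasawaAlgebra p ⧸ Ideal.span {G₁}) G₁ :=
    (Module.isTorsionBy_quotient_iff _ G₁).mpr fun y ↦ by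
      rw [smul_eq_mul]
      exact Ideal.mul_mem_right y _ (Ideal.mem_span_singleton_self G₁)
  have hfinG : lengthAt (IwasawaAlgebra p) (IwasawaAlgebra p ⧸ Ideal.span {G₁}) 𝔭 ≠ ⊤ :=
    lengthAt_ne_top_of_isTorsionBy hG0 hby 𝔭 h𝔭.le
  haveI : Module.Finite (IwasawaAlgebra p) Y := moduleFinite_fine_of_package K π hπs hπ
  have hfinY : lengthAt (IwasawaAlgebra p) Y 𝔭 ≠ ⊤ := by
    obtain ⟨s, hs, hs0⟩ :=
      Submodule.annihilator_top_inter_nonZeroDivisors (isTorsion_fine_of_package K π hπs hπ)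
    exact lengthAt_ne_top_of_isTorsionBy (nonZeroDivisors.ne_zero hs0)
      (fun m ↦ Submodule.mem_annihilator.mp hs m Submodule.mem_top) 𝔭 h𝔭.le
  constructor
  · intro hZ
    rw [hZ] at h
    exact (add_left_inj_of_ne_top hfinY).mp h
  · intro hX
    rw [hX] at h
    exact (add_right_inj_of_ne_top hfinG).mp h

omit [NeZero N] in
/-- **The INTEGRAL Mazur-form identity gives the fine identity at EVERY height-one prime.**  If
`X(E/ℚ_∞)` is finitely generated torsion with `char_Λ X = (g)`, `ι g = L_p(E,T) ≠ 0` (the shape of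
clause 3 of the tree's Skinner–Urban fact bsd.S21 and of `kato_divisibility` (3)), then for the
package's `Z` and fine quotient `Y`: `ℓ_𝔭(𝐇¹_Γ/Z) = ℓ_𝔭(Y)` for every height-one `𝔭`, `(p)` included.
[cite: Kim2025RefinedTNC, Thm. 3.19 and its proof (§3.5.3, chunk p0014:L75–L81)]
[cite: Kato2004Asterisque, §17.13 (p. 280)] -/
theorem fine_heightOne_of_charIdeal_eq_span_integral (K : DivisibilityInputs W p f κ γ I D)
    (hirr : W.HasIrreducibleModPGaloisRep p)
    (hL : padicLFunction f (unitRoot W p : ℚ_[p]) ≠ 0)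
    (π : D.X →ₗ[IwasawaAlgebra p] Y) (hπs : Function.Surjective π) (hπ : Function.Exact K.toX π)
    [Module.Finite (IwasawaAlgebra p) D.X] (hX : D.IsTorsion) {g : IwasawaAlgebra p}
    (hchar : D.charIdeal = Ideal.span {g})
    (hιg : iwasawaToPowerSeries p g = padicLFunction f (unitRoot W p : ℚ_[p]))
    (𝔭 : PrimeSpectrum (IwasawaAlgebra p)) (h𝔭 : 𝔭.asIdeal.height = 1) :
    lengthAt (IwasawaAlgebra p) (I.H ⧸ K.Z) 𝔭 = lengthAt (IwasawaAlgebra p) Y 𝔭 := by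
  refine (fine_iff_mazur_heightOne K hirr hιg hL π hπs hπ 𝔭 h𝔭).mpr ?_
  have hg0 : g ≠ 0 := by
    rintro rfl
    exact hL (by rw [← hιg, map_zero])
  have hby : Module.IsTorsionBy (IwasawaAlgebra p) (IwasawaAlgebra p ⧸ Ideal.span {g}) g :=
    (Module.isTorsionBy_quotient_iff _ g).mpr fun y ↦ by
      rw [smul_eq_mul]
      exact Ideal.mul_mem_right y _ (Ideal.mem_span_singleton_self g)
  have hQ : Module.IsTorsion (IwasawaAlgebra p) (IwasawaAlgebra p ⧸ Ideal.span {g}) :=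
    fun x ↦ ⟨⟨g, mem_nonZeroDivisors_of_ne_zero hg0⟩, @hby x⟩
  have hcharQ : charIdeal (IwasawaAlgebra p) (IwasawaAlgebra p ⧸ Ideal.span {g}) =
      Ideal.span {g} := charIdeal_eq_span_of_lengthAt_eq_quotient hg0 fun _ _ ↦ rfl
  exact SkinnerUrban2014.lengthAt_eq_of_charIdeal_eq hX hQ (hchar.trans hcharQ.symm) 𝔭 h𝔭

omit [NeZero N] in
/-- The characteristic-ideal form: under the same integral Mazur identity,
**`char_Λ(𝐇¹_Γ/Z) = char_Λ(Y)`** (lengths agree at every height-one prime,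
`Module.charIdeal_eq_of_lengthAt_eq`). [cite: Kim2025RefinedTNC, statement 3.17 (§3.5.3, chunk p0014:L43–L51)]
[cite: Kato2004Asterisque, §17.13 (p. 280)] [cite: Washington1997, §13.2] -/
theorem charIdeal_quotient_zeta_eq_of_charIdeal_eq_span_integral
    (K : DivisibilityInputs W p f κ γ I D) (hirr : W.HasIrreducibleModPGaloisRep p)
    (hL : padicLFunction f (unitRoot W p : ℚ_[p]) ≠ 0)
    (π : D.X →ₗ[IwasawaAlgebra p] Y) (hπs : Function.Surjective π) (hπ : Function.Exact K.toX π)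
    [Module.Finite (IwasawaAlgebra p) D.X] (hX : D.IsTorsion) {g : IwasawaAlgebra p}
    (hchar : D.charIdeal = Ideal.span {g})
    (hιg : iwasawaToPowerSeries p g = padicLFunction f (unitRoot W p : ℚ_[p])) :
    charIdeal (IwasawaAlgebra p) (I.H ⧸ K.Z) = charIdeal (IwasawaAlgebra p) Y :=
  charIdeal_eq_of_lengthAt_eq fun 𝔭 h𝔭 ↦
    fine_heightOne_of_charIdeal_eq_span_integral K hirr hL π hπs hπ hX hchar hιg 𝔭 h𝔭

/-- **[K25] Thm. 3.19 (SU) for an elliptic curve, VERBATIM (every height-one prime), in the fine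
currency — via Skinner–Urban 2014 Thm. 3.6.9 (refereed tree fact bsd.S21
`skinner_urban_main_conjecture`, clause 3 under tower surjectivity): at a good ordinary `p ≥ 3` with
`E[p]` irreducible, `ρ̄_{E,p^m}` onto for all `m` ("large image"), and some multiplicative `ℓ ≠ p` with
`p ∤ ord_ℓ(Δ_E)` ("`ℓ ∥ N` where `ρ̄_f` is ramified"), `ℓ_𝔭(𝐇¹_Γ/Z) = ℓ_𝔭(Y)` at EVERY height-one
prime `𝔭`**, for the cyclotomic `(κ, γ)` in the cyclotomic variable, the newform `f` of `W`, every
§17.13 package `K` with fine quotient `π : X ↠ Y`.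
[cite: Kim2025RefinedTNC, Thm. 3.19 (SU) (§3.5.3, chunk p0014:L75–L77)]
[cite: SkinnerUrban2014, Thm. 3.6.9 (p. 45)] [cite: Kato2004Asterisque, §17.13 (p. 280)] -/
theorem fine_heightOne_of_skinnerUrban
    (hSU : skinner_urban_main_conjecture W p (κ := κ) (γ := γ) (f := f))
    (hp : 3 ≤ p) (hord : IsOrdinaryAt W p) (hirr : W.HasIrreducibleModPGaloisRep p)
    (haux : ∃ ℓ : ℕ, ∃ _ : Fact ℓ.Prime, ℓ ≠ p ∧ W.HasMultiplicativeReductionAtPrime ℓ ∧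
      ¬ p ∣ padicValInt ℓ W.minimalDiscriminantInt)
    (htower : ∀ m : ℕ, W.HasSurjectiveModNGaloisRep (p ^ m : ℕ))
    (hκ : κ.IsCyclotomic) (hγ : κ.IsTopGenerator γ) (hγ' : IsCyclotomicVariable p γ)
    (hf : IsNewformOf W f) (K : DivisibilityInputs W p f κ γ I D)
    (π : D.X →ₗ[IwasawaAlgebra p] Y) (hπs : Function.Surjective π) (hπ : Function.Exact K.toX π)
    (𝔭 : PrimeSpectrum (IwasawaAlgebra p)) (h𝔭 : 𝔭.asIdeal.height = 1) :
    lengthAt (IwasawaAlgebra p) (I.H ⧸ K.Z) 𝔭 = lengthAt (IwasawaAlgebra p) Y 𝔭 := by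
  obtain ⟨hX, -, hint⟩ :=
    hSU hp ((isOrdinaryAt_iff W p).1 hord).1 ((isOrdinaryAt_iff W p).1 hord).2 hirr haux hκ hγ hγ'
      hf D
  obtain ⟨g, hιg, hchar⟩ := hint htower
  haveI : Module.Finite (IwasawaAlgebra p) D.X :=
    (WeierstrassCurve.SelmerDualData.module_finite_of_isCyclotomic (W := W) (κ := κ) hκ D) hγ
  exact fine_heightOne_of_charIdeal_eq_span_integral K hirr (padicLFunction_unitRoot_ne_zero hord hf)
    π hπs hπ hX hchar hιg 𝔭 h𝔭

/-- **Kato's main identity in the `X₀`-form (statement 3.17 of [K25] for `E`, every height-one prime)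
on the Skinner–Urban class: `char_Λ(𝐇¹_Γ(T_pW)/Z) = char_Λ(Y)`** for the package's zeta submodule
`Z` and fine quotient `Y` — hypotheses as in `fine_heightOne_of_skinnerUrban`.
[cite: Kim2025RefinedTNC, Thm. 3.19 (SU) and statement 3.17 (§3.5.3, chunks p0014:L43–L51, L75–L77)]
[cite: SkinnerUrban2014, Thm. 3.6.9 (p. 45)] [cite: Kato2004Asterisque, §17.13 (p. 280)] -/
theorem charIdeal_quotient_zeta_eq_charIdeal_fine_of_skinnerUrban
    (hSU : skinner_urban_main_conjecture W p (κ := κ) (γ := γ) (f := f))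
    (hp : 3 ≤ p) (hord : IsOrdinaryAt W p) (hirr : W.HasIrreducibleModPGaloisRep p)
    (haux : ∃ ℓ : ℕ, ∃ _ : Fact ℓ.Prime, ℓ ≠ p ∧ W.HasMultiplicativeReductionAtPrime ℓ ∧
      ¬ p ∣ padicValInt ℓ W.minimalDiscriminantInt)
    (htower : ∀ m : ℕ, W.HasSurjectiveModNGaloisRep (p ^ m : ℕ))
    (hκ : κ.IsCyclotomic) (hγ : κ.IsTopGenerator γ) (hγ' : IsCyclotomicVariable p γ)
    (hf : IsNewformOf W f) (K : DivisibilityInputs W p f κ γ I D)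
    (π : D.X →ₗ[IwasawaAlgebra p] Y) (hπs : Function.Surjective π) (hπ : Function.Exact K.toX π) :
    charIdeal (IwasawaAlgebra p) (I.H ⧸ K.Z) = charIdeal (IwasawaAlgebra p) Y :=
  charIdeal_eq_of_lengthAt_eq fun 𝔭 h𝔭 ↦
    fine_heightOne_of_skinnerUrban hSU hp hord hirr haux htower hκ hγ hγ' hf K π hπs hπ 𝔭 h𝔭

end Package

/-! ### The instance on the pinned fine Selmer dual -/

section FineSelmerDual

variable {p : ℕ} [Fact p.Prime] {W : WeierstrassCurve ℚ} [W.IsElliptic] [W.IsGloballyMinimal]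
  [ContinuousSMul ℤ_[p] (W.tateModule p)] {N : ℕ} [NeZero N] {f : CuspForm (Gamma0 N) 2}
  {κ : ZpExtension ℚ p} {γ : absoluteGaloisGroup ℚ}

/-- **[K25] Thm. 3.19 (SU) / Kato's main identity in the `X₀`-form for `E/ℚ` on the Skinner–Urban
class with large image, on the pinned objects `𝐇¹_Γ(T_pW)` and `X₀(E/ℚ_∞) = Y.X`, MODULO the named
facts `skinner_urban_main_conjecture` (S–U Thm. 3.6.9, refereed) and
`Kato2004.exists_divisibilityInputs_fineQuotient` (Kato's §17.13 package with the fine quotient):**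
there are a package `K` and a fine quotient `π : X ↠ X₀` with
`char_Λ(I.H/K.Z) = char_Λ(Y.X)` (`= Y.charIdeal`) and `ℓ_𝔭(I.H/K.Z) = ℓ_𝔭(Y.X)` at every
height-one `𝔭`. [cite: Kim2025RefinedTNC, Thm. 3.19 (SU) (§3.5.3, chunk p0014:L75–L77)]
[cite: SkinnerUrban2014, Thm. 3.6.9 (p. 45)] [cite: Kato2004Asterisque, (14.9.3) (p. 240) and §17.13 (pp. 279–280)] -/
theorem exists_charIdeal_quotient_zeta_eq_of_skinnerUrban_of_fineQuotient
    (hSU : skinner_urban_main_conjecture W p (κ := κ) (γ := γ) (f := f))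
    (hfine : exists_divisibilityInputs_fineQuotient) (hp : 3 ≤ p) (hord : IsOrdinaryAt W p)
    (hirr : W.HasIrreducibleModPGaloisRep p)
    (haux : ∃ ℓ : ℕ, ∃ _ : Fact ℓ.Prime, ℓ ≠ p ∧ W.HasMultiplicativeReductionAtPrime ℓ ∧
      ¬ p ∣ padicValInt ℓ W.minimalDiscriminantInt)
    (htower : ∀ m : ℕ, W.HasSurjectiveModNGaloisRep (p ^ m : ℕ))
    (hκ : κ.IsCyclotomic) (hγ : κ.IsTopGenerator γ) (hγ' : IsCyclotomicVariable p γ)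
    (hf : IsNewformOf W f)
    (I : IwasawaH1Data W p κ γ) (D : W.SelmerDualData κ γ) (Y : W.FineSelmerDualData κ γ) :
    ∃ (K : DivisibilityInputs W p f κ γ I D) (π : D.X →ₗ[IwasawaAlgebra p] Y.X),
      Function.Surjective π ∧ Function.Exact K.toX π ∧
      charIdeal (IwasawaAlgebra p) (I.H ⧸ K.Z) = Y.charIdeal ∧
      ∀ 𝔭 : PrimeSpectrum (IwasawaAlgebra p), 𝔭.asIdeal.height = 1 →
        lengthAt (IwasawaAlgebra p) (I.H ⧸ K.Z) 𝔭 = lengthAt (IwasawaAlgebra p) Y.X 𝔭 := by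
  have hp2 : p ≠ 2 := by rintro rfl; norm_num at hp
  obtain ⟨K, π, hπs, hπ⟩ := hfine W p f κ γ hp2 hord hκ hγ hγ' hf I D Y
  exact ⟨K, π, hπs, hπ,
    charIdeal_quotient_zeta_eq_charIdeal_fine_of_skinnerUrban hSU hp hord hirr haux htower hκ hγ hγ'
      hf K π hπs hπ,
    fun 𝔭 h𝔭 ↦ fine_heightOne_of_skinnerUrban hSU hp hord hirr haux htower hκ hγ hγ' hf K π hπs hπ
      𝔭 h𝔭⟩

end FineSelmerDual

end Literature.NumberTheory.EllipticCurves.Kim2025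

end
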